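import Literature.NumberTheory.GaloisRepresentations.IdeleSUnitsLayerChaseTwo
import HarnessLib

/-!
# The finite-layer chase of NSW (8.3.11) for the `S`-units, II: `p`-torsion of `H³(Gal(E/F), 𝒪ˣ_{E,S})` dies up the
# layers of `K_S` (cochain level inside `J_E`)

Topic `NumberTheory/GaloisRepresentations`; namespace `Literature.NumberTheory.GaloisRepresentations.IdeleCohomology`.
THEOREMS ONLY.  Sequel of `IdeleSUnitsLayerChaseTwo` (same binders, same method; see its module docstring for the setting):

* `inf_inf_sUnits_three_eq_zero` — **NSW (8.3.11) (iv) at finite layers**: for layers `F ⊆ E ⊆ E₁ ⊆ E₂` and the principal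
  `S`-idèles `O_• ⊆ J_{E_•,S}`, if `x ∈ H³(Gal(E/F), O)` with `m • x = 0`, `H³(Gal(E/F), J_{E,S}) = 0` (Tate; the lane's
  `isZero_H3_ideleSRep` at a totally complex `F`), the class `y ∈ H²(Gal(E/F), C_E)` the chase attaches to `x` — whose
  multiple `m • y` is the class of an `S`-idèle class — becomes at `E₁` the class of an `S`-idèle class (hypothesis `hreal`, the
  local-degree input of (8.3.11)), and every idèle of `E₁` lies in `E₂ˣ · J_{E₂,S}` (capitulation), then
  `Inf_{E₁→E₂} (Inf_{E→E₁} x) = 0`.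

Proof: a cocycle `c` of `x` bounds in `J_{E,S}`, `ιS ∘ c = d j`; `y := [j mod Eˣ]`; at `E₁` the hypothesis writes
`Inf j ≡ z₀ + d r + (principal)` with `z₀` an `S`-idèle cocycle and `r : Gal(E₁/F) → J_{E₁}`; capitulating the values of `r` in
`E₂` produces a `2`-cochain `w` of `O₂` with `d w = -Inf Inf c`.

## References
* J. Neukirch, A. Schmidt, K. Wingberg, *Cohomology of Number Fields*, 2nd ed. (2008), (8.3.11) (iv), (8.3.17), (8.3.18).
  [NeukirchSchmidtWingberg2008]
* D. Harari, *Galois Cohomology and Class Field Theory* (2020), §17.4, Cor. 17.14. [Harari2020]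
-/

noncomputable section

open CategoryTheory NumberField IsDedekindDomain groupCohomology
open Literature.Algebra.Homology Literature.Algebra.Homology.InhomogeneousCochains Literature.NumberTheory.Automorphic

namespace Literature.NumberTheory.GaloisRepresentations

namespace IdeleCohomology

section HThree

variable {F E E₁ E₂ : Type} [Field F] [NumberField F] [Field E] [NumberField E] [Field E₁] [NumberField E₁]
  [Field E₂] [NumberField E₂]
  [Algebra F E] [Algebra F E₁] [Algebra F E₂] [Algebra E E₁] [Algebra E₁ E₂]
  [IsScalarTower F E E₁] [IsScalarTower F E₁ E₂] [IsGalois F E] [IsGalois F E₁]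
  {S : Finset (HeightOneSpectrum (𝓞 F))}

/-- **NSW (8.3.11) (iv), finite layers — `p`-torsion of `H³(·, 𝒪ˣ_S)` dies up the tower.**  Same binders as
`exists_smul_eq_inf_inf_sUnits_two`.  Let `x ∈ H³(G, O)` with `m • x = 0`, and assume `H³(G, J_{E,S}) = 0` (Tate; `F` totally
complex, `S ⊇` the ramified places — the lane's `isZero_H3_ideleSRep`).  The chase attaches to `x` a class `y ∈ H²(G, C_E)` (a
cocycle `c` of `x` is `d j` in `J_{E,S}`, and `y = [j mod Eˣ]`), whose multiple `m • y` is the class of an `S`-idèle class; if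
(hypothesis `hreal`, supplied by the local-invariant arithmetic of the sequel from the growth of the local degrees at `S`) every
such `y` becomes at the layer `E₁` the class of an `S`-idèle class, and every idèle of `E₁` lies in `E₂ˣ · J_{E₂,S}`, then
`Inf_{E₁→E₂} (Inf_{E→E₁} x) = 0` in `H³(G₂, O₂)`.
[cite: NeukirchSchmidtWingberg2008, (8.3.11) (iv) and its use in (8.3.17)–(8.3.18)] [cite: Harari2020, Cor. 17.14, §17.4] -/
theorem inf_inf_sUnits_three_eq_zero
    -- the `S`-unit objects at the three layers
    {O : Rep ℤ (E ≃ₐ[F] E)} (ιS : O ⟶ ideleSRep F E S)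
    {O₁ : Rep ℤ (E₁ ≃ₐ[F] E₁)} (ιS₁ : O₁ ⟶ ideleSRep F E₁ S)
    {O₂ : Rep ℤ (E₂ ≃ₐ[F] E₂)} (ιS₂ : O₂ ⟶ ideleSRep F E₂ S)
    (hι₂ : Function.Injective ιS₂.hom)
    (hO₂ : ∀ x : ideleSRep F E₂ S, (∃ o, ιS₂.hom o = x) ↔
      ((Additive.toMul x : ideleS F E₂ S) : ideleGroup E₂) ∈ principalIdeles E₂)
    -- the layer-change pair morphisms and their squares
    (inflS₁ : Rep.res (AlgEquiv.restrictNormalHom E) (ideleSRep F E S) ⟶ ideleSRep F E₁ S)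
    (inflS₂ : Rep.res (AlgEquiv.restrictNormalHom E₁) (ideleSRep F E₁ S) ⟶ ideleSRep F E₂ S)
    (inflO₁ : Rep.res (AlgEquiv.restrictNormalHom E) O ⟶ O₁)
    (inflO₂ : Rep.res (AlgEquiv.restrictNormalHom E₁) O₁ ⟶ O₂)
    (hS₁ : ∀ x, (ideleSRepHom S).hom (inflS₁.hom x) = (ideleInflHom F E E₁).hom ((ideleSRepHom S).hom x))
    (hS₂ : ∀ x, (ideleSRepHom S).hom (inflS₂.hom x) = (ideleInflHom F E₁ E₂).hom ((ideleSRepHom S).hom x))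
    (hO₁inf : ∀ o, ιS₁.hom (inflO₁.hom o) = inflS₁.hom (ιS.hom o))
    (hO₂inf : ∀ o, ιS₂.hom (inflO₂.hom o) = inflS₂.hom (ιS₁.hom o))
    -- capitulation of the idèles of `E₁` in `E₂`
    (hcap : ∀ a : ideleGroup E₁,
      Literature.NumberTheory.Automorphic.AdeleRing.ideleBaseChange E₁ E₂ a ∈ principalIdeles E₂ ⊔ ideleS F E₂ S)
    (hO : ∀ x : ideleSRep F E S, (∃ o, ιS.hom o = x) ↔
      ((Additive.toMul x : ideleS F E S) : ideleGroup E) ∈ principalIdeles E)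
    -- `H³(G, J_{E,S}) = 0`
    (hH3 : Limits.IsZero (groupCohomology (ideleSRep F E S) 3))
    -- the data
    (x : groupCohomology O 3) (m : ℤ) (hm : m • x = 0)
    (hreal : ∀ y : groupCohomology (IdeleClassGroup.galoisRep F E) 2,
      (∃ ξ : groupCohomology (ideleSRep F E S) 2,
          map (MonoidHom.id _) (ideleSRepHom S ≫ IdeleClassGroup.classRepHom F E) 2 ξ = m • y) →
      ∃ ζ : groupCohomology (ideleSRep F E₁ S) 2,
        map (MonoidHom.id _) (ideleSRepHom S ≫ IdeleClassGroup.classRepHom F E₁) 2 ζ = classInf F E E₁ 2 y) :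
    map (AlgEquiv.restrictNormalHom E₁) inflO₂ 3 (map (AlgEquiv.restrictNormalHom E) inflO₁ 3 x) = 0 := by
  classical
  -- Step 0: a cocycle of `x`; it bounds in `J_{E,S}`: `ιS ∘ c = d j`.
  obtain ⟨cc, rfl⟩ := π_surjective _ _ x
  have hιpr : ∀ o : O, (IdeleClassGroup.classRepHom F E).hom ((ideleSRepHom S).hom (ιS.hom o)) = 0 :=
    fun o => (classRepHom_hom_eq_zero_iff _).2 ((hO _).1 ⟨o, rfl⟩)
  obtain ⟨j, hj⟩ := exists_d_eq_of_isZero hH3 ((cochainsMap (MonoidHom.id _) ιS).f 3 (iCocycles O 3 cc))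
    (by rw [d_cochainsMap_f, d_iCocycles, cochainsMap_f_zero])
  -- Step 1: the class `y = [q ∘ πS ∘ j] ∈ H²(G, C_E)`.
  have hyc : inhomogeneousCochains.d (IdeleClassGroup.galoisRep F E) 2
      ((cochainsMap (MonoidHom.id _) (ideleSRepHom S ≫ IdeleClassGroup.classRepHom F E)).f 2 j) = 0 := by
    rw [d_cochainsMap_f, hj]
    funext g
    rw [cochainsMap_id_f_apply, cochainsMap_id_f_apply, Rep.comp_apply, hιpr]
    rfl
  -- Step 2: the readout `m • y` is the class of the `S`-idèle class `m • j - ιS ∘ e`, where `d e = m • c`.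
  have hmx : π O 3 (m • cc) = 0 := by rw [π_zsmul, hm]
  obtain ⟨e, he⟩ := (groupCohomology_π_eq_zero_iff _ 2 _).1 hmx
  rw [iCocycles_zsmul] at he
  have hξ₀ : inhomogeneousCochains.d (ideleSRep F E S) 2 (m • j - (cochainsMap (MonoidHom.id _) ιS).f 2 e) = 0 := by
    rw [d_apply_sub, d_apply_zsmul, hj, d_cochainsMap_f, he, cochainsMap_f_zsmul, sub_self]
  have hξ : map (MonoidHom.id _) (ideleSRepHom S ≫ IdeleClassGroup.classRepHom F E) 2
      (π _ 2 (cocyclesMk _ hξ₀)) = m • π _ 2 (cocyclesMk _ hyc) := by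
    rw [π_map_apply, ← π_zsmul]
    refine (groupCohomology_π_eq_iff _ 1 _ _).2 ⟨0, ?_⟩
    have h0 : (cochainsMap (MonoidHom.id _) (ideleSRepHom S ≫ IdeleClassGroup.classRepHom F E)).f 2
        ((cochainsMap (MonoidHom.id _) ιS).f 2 e) = 0 := by
      funext g
      rw [cochainsMap_id_f_apply, cochainsMap_id_f_apply, Rep.comp_apply, hιpr]
      rfl
    rw [d_apply_zero, iCocycles_cocyclesMap_res, iCocycles_mk, iCocycles_zsmul, iCocycles_mk, cochainsMap_f_sub,
      cochainsMap_f_zsmul, h0, sub_zero, sub_self]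
  -- Step 3: at the layer `E₁`, `Inf y` is the class of an `S`-idèle class `ζ`.
  obtain ⟨ζ, hζ⟩ := hreal _ ⟨_, hξ⟩
  obtain ⟨zc, rfl⟩ := π_surjective _ _ ζ
  have hz₀ : inhomogeneousCochains.d (ideleSRep F E₁ S) 2 (iCocycles _ 2 zc) = 0 := d_iCocycles _ 2 zc
  have h3 : π (IdeleClassGroup.galoisRep F E₁) 2
      (cocyclesMap (MonoidHom.id _) (ideleSRepHom S ≫ IdeleClassGroup.classRepHom F E₁) 2 zc) =
      π (IdeleClassGroup.galoisRep F E₁) 2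
        (cocyclesMap (AlgEquiv.restrictNormalHom E) (classInflHom F E E₁) 2 (cocyclesMk _ hyc)) := by
    rw [← π_map_apply, ← π_map_apply, hζ]
    rfl
  obtain ⟨ρ, hρ⟩ := (groupCohomology_π_eq_iff _ 1 _ _).1 h3
  rw [iCocycles_cocyclesMap_res, iCocycles_cocyclesMap_res, iCocycles_mk] at hρ
  have hr' := fun g => exists_classRepHom_eq (F := F) (ρ g)
  choose r hr using hr'
  have hρr : ρ = (cochainsMap (MonoidHom.id _) (IdeleClassGroup.classRepHom F E₁)).f 1 r :=
    funext fun g => by rw [cochainsMap_id_f_apply]; exact (hr g).symm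
  -- `πS ∘ (z₀ - Inf_S j) - d r` is pointwise principal: `= pr ∘ b`.
  have hb' : ∀ g, ∃ u : Rep.ofAlgebraAutOnUnits F E₁, (IdeleClassGroup.principalRepHom F E₁).hom u =
      (ideleSRepHom S).hom ((iCocycles _ 2 zc - (cochainsMap (AlgEquiv.restrictNormalHom E) inflS₁).f 2 j) g) -
        inhomogeneousCochains.d (IdeleClassGroup.ideleRep F E₁) 1 r g := by
    intro g
    refine exists_principalRepHom_eq_of_classRepHom_eq_zero _ ?_
    have := congrFun hρ g
    rw [hρr, d_cochainsMap_f, cochainsMap_id_f_apply, Pi.sub_apply, cochainsMap_id_f_apply, Rep.comp_apply,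
      cochainsMap_res_f_apply, cochainsMap_id_f_apply, Rep.comp_apply, classInflHom_classRepHom, ← hS₁] at this
    rw [map_sub, sub_eq_zero, this, Pi.sub_apply, map_sub, map_sub, cochainsMap_res_f_apply]
  choose b hb using hb'
  -- Step 4: capitulate the values of `r` in `E₂`.
  have hcr : ∀ g, ∃ (u : Rep.ofAlgebraAutOnUnits F E₂) (w : ideleSRep F E₂ S),
      (IdeleClassGroup.principalRepHom F E₂).hom u + (ideleSRepHom S).hom w = (ideleInflHom F E₁ E₂).hom (r g) :=
    fun g => by
      rw [ideleInflHom_hom_apply]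
      exact exists_principal_add_ideleS_eq_of_mem_sup _ (hcap (Additive.toMul (r g)))
  choose γr 𝔧r hγ𝔧r using hcr
  obtain ⟨γr₂, hγr₂⟩ : ∃ t : (inhomogeneousCochains (Rep.ofAlgebraAutOnUnits F E₂)).X 1,
      ∀ g, t g = γr (AlgEquiv.restrictNormalHom E₁ ∘ g) := ⟨_, fun _ => rfl⟩
  obtain ⟨𝔧r₂, h𝔧r₂⟩ : ∃ t : (inhomogeneousCochains (ideleSRep F E₂ S)).X 1,
      ∀ g, t g = 𝔧r (AlgEquiv.restrictNormalHom E₁ ∘ g) := ⟨_, fun _ => rfl⟩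
  have hInfr : (cochainsMap (AlgEquiv.restrictNormalHom E₁) (ideleInflHom F E₁ E₂)).f 1 r =
      (cochainsMap (MonoidHom.id _) (IdeleClassGroup.principalRepHom F E₂)).f 1 γr₂ +
        (cochainsMap (MonoidHom.id _) (ideleSRepHom S)).f 1 𝔧r₂ := by
    funext g
    rw [cochainsMap_res_f_apply, Pi.add_apply, cochainsMap_id_f_apply, cochainsMap_id_f_apply, hγr₂, h𝔧r₂, hγ𝔧r]
  -- Step 5: `Inf_S (z₀ - Inf_S j) - d 𝔧r₂` has principal image, hence comes from `O₂`.
  have hw' : ∀ g, ∃ o : O₂, ιS₂.hom o =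
      ((cochainsMap (AlgEquiv.restrictNormalHom E₁) inflS₂).f 2
          (iCocycles _ 2 zc - (cochainsMap (AlgEquiv.restrictNormalHom E) inflS₁).f 2 j) -
        inhomogeneousCochains.d (ideleSRep F E₂ S) 1 𝔧r₂) g := by
    intro g
    refine (hO₂ _).2 (toMul_mem_principalIdeles_of_ideleSRepHom_eq _
      (inhomogeneousCochains.d (Rep.ofAlgebraAutOnUnits F E₂) 1 γr₂ g +
        (unitsInflHom F E₁ E₂).hom (b (AlgEquiv.restrictNormalHom E₁ ∘ g))) ?_)
    have hz : (ideleSRepHom S).hom ((iCocycles _ 2 zc - (cochainsMap (AlgEquiv.restrictNormalHom E) inflS₁).f 2 j)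
        (AlgEquiv.restrictNormalHom E₁ ∘ g)) =
        inhomogeneousCochains.d (IdeleClassGroup.ideleRep F E₁) 1 r (AlgEquiv.restrictNormalHom E₁ ∘ g) +
          (IdeleClassGroup.principalRepHom F E₁).hom (b (AlgEquiv.restrictNormalHom E₁ ∘ g)) := by
      rw [hb, add_sub_cancel]
    have hdr : (ideleInflHom F E₁ E₂).hom
        (inhomogeneousCochains.d (IdeleClassGroup.ideleRep F E₁) 1 r (AlgEquiv.restrictNormalHom E₁ ∘ g)) =
        (IdeleClassGroup.principalRepHom F E₂).hom (inhomogeneousCochains.d (Rep.ofAlgebraAutOnUnits F E₂) 1 γr₂ g) +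
          (ideleSRepHom S).hom (inhomogeneousCochains.d (ideleSRep F E₂ S) 1 𝔧r₂ g) := by
      rw [← cochainsMap_res_f_apply (AlgEquiv.restrictNormalHom E₁) (ideleInflHom F E₁ E₂), ← d_cochainsMap_f, hInfr,
        d_apply_add, Pi.add_apply, d_cochainsMap_f, d_cochainsMap_f, cochainsMap_id_f_apply, cochainsMap_id_f_apply]
    rw [Pi.sub_apply, map_sub, cochainsMap_res_f_apply, hS₂, hz, map_add, hdr, ideleInflHom_principalRepHom, map_add]
    abel
  choose w hw using hw'
  -- Step 6: `d w = - Inf Inf c` by injectivity of `ιS₂` on cochains.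
  have hιw : (fun h => ιS₂.hom (w h)) = (cochainsMap (AlgEquiv.restrictNormalHom E₁) inflS₂).f 2
      (iCocycles _ 2 zc - (cochainsMap (AlgEquiv.restrictNormalHom E) inflS₁).f 2 j) -
      inhomogeneousCochains.d (ideleSRep F E₂ S) 1 𝔧r₂ := funext hw
  have hInfc : (cochainsMap (MonoidHom.id _) ιS₂).f 3
      ((cochainsMap (AlgEquiv.restrictNormalHom E₁) inflO₂).f 3
        ((cochainsMap (AlgEquiv.restrictNormalHom E) inflO₁).f 3 (iCocycles O 3 cc))) =
      (cochainsMap (AlgEquiv.restrictNormalHom E₁) inflS₂).f 3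
        ((cochainsMap (AlgEquiv.restrictNormalHom E) inflS₁).f 3
          ((cochainsMap (MonoidHom.id _) ιS).f 3 (iCocycles O 3 cc))) := by
    funext g
    change ιS₂.hom (inflO₂.hom (inflO₁.hom _)) = inflS₂.hom (inflS₁.hom (ιS.hom _))
    rw [hO₂inf, hO₁inf]
    exact rfl
  have hdw : inhomogeneousCochains.d O₂ 2 (-w) = (cochainsMap (AlgEquiv.restrictNormalHom E₁) inflO₂).f 3
        ((cochainsMap (AlgEquiv.restrictNormalHom E) inflO₁).f 3 (iCocycles O 3 cc)) := by
    funext g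
    apply hι₂
    have hc := congrFun hInfc g
    rw [cochainsMap_id_f_apply] at hc
    rw [d_apply_neg, Pi.neg_apply, map_neg, ← d_comp_hom_apply ιS₂ w g, hιw, d_apply_sub, d_cochainsMap_f, d_apply_sub,
      hz₀, d_cochainsMap_f, hj, d_apply_d_apply, sub_zero, zero_sub, hc, cochainsMap_f_neg, Pi.neg_apply, neg_neg]
  -- Step 7: conclusion.
  rw [π_map_apply, π_map_apply]
  refine (groupCohomology_π_eq_zero_iff _ 2 _).2 ⟨-w, ?_⟩
  rw [hdw, iCocycles_cocyclesMap_res, iCocycles_cocyclesMap_res]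

end HThree

end IdeleCohomology

end Literature.NumberTheory.GaloisRepresentations

end
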